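/- Width seat `ym-line-cbag-p1-w3` (prover-ym-line-cbag-p1-w3-g0-0), route `ColdBoxAllGroups`, crux `BoxFloorAllGroups`
(stmt-QuantumFields-22254), line `birth`, skeleton v4: glue «LinkSmallG» toward the lead's load-bearing stub S2
`stub_boxDirichletDominationAbsG` (brick R1 of the one-scale expansion, every compact `G`). -/
import Summits.QuantumFields.YangMills.Theorems.WeakCouplingRatesColdBoxLinkSmall
import Summits.QuantumFields.YangMills.Theorems.EquipartitionCriticalityEquipartitionPinsProbeTangentCombPoincare
import Summits.QuantumFields.YangMills.Theorems.EquipartitionCriticalityFreeEnergyLogCoefficientExpChartBasic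
import Literature.MathematicalPhysics.QuantumFieldTheory.WilsonPlaquetteWeakCouplingFloor

/-!
# Crux `BoxFloorAllGroups`, glue «LinkSmallG»: SMALL PLAQUETTES ⇒ SMALL LINKS in the temporal-forest gauge of the cold-wall box,
# for EVERY compact group presented in `U(N)` (brick R1 of the one-scale expansion, `G`-generic)

The `G`-generic replacement of the `SU(2)` brick `WeakCouplingRatesColdBoxLinkSmall` (there: the operator-norm length on `SU(2)` with
`ℓ² = 2 − Re tr U` exactly), for the all-groups crux `BoxFloorAllGroups` of route `ColdBoxAllGroups` (skeleton v4, stub S2).  The length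
function is the FROBENIUS distance to the identity along the representation, `ℓ(g) = ‖ρ(g) − 1‖_F`, for which
`ℓ(g)² = 2·(N − Re tr ρ(g))` EXACTLY for unitary `ρ` (tree: `TangentCombPoincare.norm_sub_one_sq`), `ℓ(gh) ≤ ℓ(g) + ℓ(h)`
(`TangentCombPoincare.norm_mul_sub_one_le`), `ℓ(g⁻¹) = ℓ(g)`.  Hence for a configuration `V` on `ℤ⁴` which is `1` off the cold box
`Λ = boxEdges 4 (2H+1)` and on the temporal forest, all of whose plaquettes touching `Λ` cost `N − Re tr ρ(V_p) ≤ δ²`: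
* `frobDist_hol_le_of_plaqCost_le` — every plaquette holonomy (all `x i j`, degenerate, reversed, off the box) has `ℓ ≤ √2·δ`;
* **`frobDist_link_le_of_plaqCost_le`** — by the abstract forest Poincaré ladder `ell_le_uniform` (`…ColdBoxForestPoincare`, any length
  function): every link has `‖ρ(V_e) − 1‖_F ≤ (12H² + 2H + 1)·√2·δ`, and `linkCost_le_of_plaqCost_le_of_rep` — every link costs
  `N − Re tr ρ(V_e) ≤ ((12H² + 2H + 1)·δ)²·… = (12H²+2H+1)²·δ²`;
* **`norm_chart_le_of_plaqCost_le`** — if moreover the links are chart points `V_e = expChart ρ (a e)` with `‖a e‖ ≤ 1/16` a priori (the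
  integration domain of the one-scale expansion), then every chart coordinate has `‖a e‖ ≤ 2·(12H²+2H+1)·√2·δ` (inverse Lipschitz bound of
  the exponential chart, `le_norm_rho_expChart_sub`).  On the small-field event (`δ² = β^{2ε−1}`, `H = ⌈β^θ⌉`) this is the sup-norm link
  bound `η ≍ H²β^{ε−1/2} → 0` iff `2θ + ε < ½`, feeding the cubic remainder of glue «CubicG» and the soft Jacobian bound
  `|log(f/c_H)| ≤ 16·D·η` per link.
No sorry; no definition; standard axioms.  NOT a claim about the Yang–Mills mass gap (rung-level support, RECORD label).
-/

set_option autoImplicit false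

noncomputable section

open Finset
open scoped Matrix.Norms.Frobenius
open Literature.Probability.LatticeModels (Site)
open Literature.MathematicalPhysics.QuantumLattice
open Literature.MathematicalPhysics.QuantumFieldTheory
open Literature.MathematicalPhysics.QuantumFieldTheory.AxialGauge

namespace Summit.QuantumFields.YangMills.Theorems.ColdBoxAllGroups

open Summit.QuantumFields.YangMills.Theorems.WeakCouplingRates
open Summit.QuantumFields.YangMills.Theorems.EquipartitionPinsProbe

variable {N : ℕ} {G : Type} [Group G] (ρ : G →* Matrix (Fin N) (Fin N) ℂ)
  (hρu : ∀ g, ρ g ∈ Matrix.unitaryGroup (Fin N) ℂ) {H : ℕ}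

/-! ## The Frobenius length function `ℓ(g) = ‖ρ(g) − 1‖_F` of a unitary representation -/

include hρu in
/-- `ℓ(g⁻¹) = ℓ(g)`: `ρ(g⁻¹) = ρ(g)ᴴ` and `‖(ρ g − 1)ᴴ‖_F = ‖ρ g − 1‖_F`. -/
theorem frobDist_inv (g : G) : ‖ρ g⁻¹ - 1‖ = ‖ρ g - 1‖ := by
  rw [TangentCombPoincare.map_inv_eq_conjTranspose ρ hρu, ← Matrix.frobenius_norm_conjTranspose (ρ g - 1),
    Matrix.conjTranspose_sub, Matrix.conjTranspose_one]

include hρu in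
/-- `ℓ(gh) ≤ ℓ(g) + ℓ(h)` (left unitary invariance of the Frobenius norm). -/
theorem frobDist_mul_le (g h : G) : ‖ρ (g * h) - 1‖ ≤ ‖ρ g - 1‖ + ‖ρ h - 1‖ := by
  rw [map_mul]; exact TangentCombPoincare.norm_mul_sub_one_le (hρu g) _

include hρu in
/-- `ℓ(g) ≤ √2·δ` when the cost `N − Re tr ρ(g) ≤ δ²` (`ℓ² = 2·cost`, `δ ≥ 0`). -/
theorem frobDist_le_of_cost_le {g : G} {δ : ℝ} (hδ : 0 ≤ δ) (h : (N : ℝ) - (ρ g).trace.re ≤ δ ^ 2) :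
    ‖ρ g - 1‖ ≤ Real.sqrt 2 * δ := by
  have hsq : ‖ρ g - 1‖ ^ 2 ≤ (Real.sqrt 2 * δ) ^ 2 := by
    rw [TangentCombPoincare.norm_sub_one_sq (hρu g), mul_pow, Real.sq_sqrt (by norm_num)]; linarith
  exact (pow_le_pow_iff_left₀ (norm_nonneg _) (by positivity) two_ne_zero).1 hsq

include hρu in
/-- Conversely the cost is `ℓ²/2`: `N − Re tr ρ(g) ≤ η²/2` when `ℓ(g) ≤ η`. -/
theorem cost_le_of_frobDist_le {g : G} {η : ℝ} (h : ‖ρ g - 1‖ ≤ η) : (N : ℝ) - (ρ g).trace.re ≤ η ^ 2 / 2 := by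
  rw [sub_re_trace_eq_half_norm_sub_one_sq (hρu g)]
  exact div_le_div_of_nonneg_right (pow_le_pow_left₀ (norm_nonneg _) h 2) (by norm_num)

/-! ## Small plaquettes ⇒ small links -/

/-- The plaquette cost read through the holonomy: `plaqCostAt ρ x i j U = N − Re tr ρ(U_p)`. -/
theorem plaqCostAt_eq_sub_trace (x : Site 4) (i j : Fin 4) (U : LGConfig 4 G) :
    plaqCostAt ρ x i j U = (N : ℝ) - (ρ (plaquetteHolonomyZd U x i j)).trace.re := rfl

include hρu in
/-- **Every plaquette holonomy is `ℓ`-small** if every plaquette touching the cold box costs `≤ δ²` and the configuration is `1` off the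
box (degenerate plaquettes and plaquettes off the box are `1`; reversed plaquettes are inverses). -/
theorem frobDist_hol_le_of_plaqCost_le (V : LGConfig 4 G) (hout : ∀ e, e ∉ boxEdges 4 (2 * H + 1) → V e = 1) {δ : ℝ} (hδ : 0 ≤ δ)
    (hcost : ∀ p ∈ plaquettesTouching (boxEdges 4 (2 * H + 1)), plaqCostAt ρ p.1 p.2.1.1 p.2.1.2 V ≤ δ ^ 2)
    (x : Site 4) (i j : Fin 4) : ‖ρ (plaquetteHolonomyZd V x i j) - 1‖ ≤ Real.sqrt 2 * δ := by
  have hδ' : 0 ≤ Real.sqrt 2 * δ := by positivity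
  -- the case `i < j`
  have hlt : ∀ i j : Fin 4, i < j → ‖ρ (plaquetteHolonomyZd V x i j) - 1‖ ≤ Real.sqrt 2 * δ := by
    intro i j hij
    by_cases hp : ((x, ⟨(i, j), hij⟩) : ZdPlaquette 4) ∈ plaquettesTouching (boxEdges 4 (2 * H + 1))
    · have h := hcost _ hp
      rw [plaqCostAt_eq_sub_trace] at h
      exact frobDist_le_of_cost_le ρ hρu hδ h
    · rw [plaquetteHolonomyZd_eq_one_of_not_touching V hout hij hp, map_one, sub_self, norm_zero]
      exact hδ'
  rcases lt_trichotomy i j with hij | rfl | hji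
  · exact hlt i j hij
  · have : plaquetteHolonomyZd V x i i = 1 := by simp [plaquetteHolonomyZd]
    rw [this, map_one, sub_self, norm_zero]; exact hδ'
  · rw [plaquetteHolonomyZd_swap, frobDist_inv ρ hρu]
    exact hlt j i hji

include hρu in
/-- **Small plaquettes ⇒ small links, every compact group presented in `U(N)`** (the abstract forest Poincaré ladder `ell_le_uniform` for
the Frobenius length): if `V` is `1` off the cold box and on the temporal forest and every plaquette touching the box costs `≤ δ²`
(`δ ≥ 0`, `H ≥ 1`), then every link has `‖ρ(V_e) − 1‖_F ≤ (12H² + 2H + 1)·√2·δ`. -/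
theorem frobDist_link_le_of_plaqCost_le (hH : 1 ≤ H) (V : LGConfig 4 G) (hout : ∀ e, e ∉ boxEdges 4 (2 * H + 1) → V e = 1)
    (hforest : ∀ x : Site 4, (∀ k : Fin 4, 1 ≤ x k ∧ x k + 1 ≤ 2 * (H : ℤ)) → V (x, 0) = 1) {δ : ℝ} (hδ : 0 ≤ δ)
    (hcost : ∀ p ∈ plaquettesTouching (boxEdges 4 (2 * H + 1)), plaqCostAt ρ p.1 p.2.1.1 p.2.1.2 V ≤ δ ^ 2)
    (e : Literature.MathematicalPhysics.QuantumLattice.ZdEdge 4) :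
    ‖ρ (V e) - 1‖ ≤ (12 * (H : ℝ) ^ 2 + 2 * H + 1) * (Real.sqrt 2 * δ) :=
  ell_le_uniform (fun g : G => ‖ρ g - 1‖) (by rw [map_one, sub_self, norm_zero]) (frobDist_mul_le ρ hρu) (frobDist_inv ρ hρu)
    V hout hforest (M := Real.sqrt 2 * δ) (frobDist_hol_le_of_plaqCost_le ρ hρu V hout hδ hcost) hH e

include hρu in
/-- **Link costs from plaquette costs**: under the same hypotheses every link costs `N − Re tr ρ(V_e) ≤ (12H² + 2H + 1)²·δ²`. -/
theorem linkCost_le_of_plaqCost_le_of_rep (hH : 1 ≤ H) (V : LGConfig 4 G) (hout : ∀ e, e ∉ boxEdges 4 (2 * H + 1) → V e = 1)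
    (hforest : ∀ x : Site 4, (∀ k : Fin 4, 1 ≤ x k ∧ x k + 1 ≤ 2 * (H : ℤ)) → V (x, 0) = 1) {δ : ℝ} (hδ : 0 ≤ δ)
    (hcost : ∀ p ∈ plaquettesTouching (boxEdges 4 (2 * H + 1)), plaqCostAt ρ p.1 p.2.1.1 p.2.1.2 V ≤ δ ^ 2)
    (e : Literature.MathematicalPhysics.QuantumLattice.ZdEdge 4) :
    (N : ℝ) - (ρ (V e)).trace.re ≤ (12 * (H : ℝ) ^ 2 + 2 * H + 1) ^ 2 * δ ^ 2 := by
  have h := cost_le_of_frobDist_le ρ hρu (frobDist_link_le_of_plaqCost_le ρ hρu hH V hout hforest hδ hcost e)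
  have e2 : ((12 * (H : ℝ) ^ 2 + 2 * H + 1) * (Real.sqrt 2 * δ)) ^ 2 / 2 = (12 * (H : ℝ) ^ 2 + 2 * H + 1) ^ 2 * δ ^ 2 := by
    rw [mul_pow, mul_pow, Real.sq_sqrt (by norm_num)]; ring
  rwa [e2] at h

/-! ## The chart-coordinate bound -/

section Chart

open Summit.QuantumFields.YangMills.Theorems.FreeEnergyLogCoefficient

variable [TopologicalSpace G] [CompactSpace G]

/-- **Inverse Lipschitz bound of the exponential chart at the origin**: for `‖a‖ ≤ 1/16`, `‖a‖ ≤ 2·‖ρ(expChart ρ a) − 1‖_F`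
(`(2 − e^{1/16})‖a‖ ≤ ‖ρψ(a) − ρψ(0)‖`, `2 − e^{1/16} ≥ ½`). -/
theorem norm_le_two_mul_frobDist_expChart (hρ : Continuous ρ) (hinj : Function.Injective ρ)
    {a : EuclideanSpace ℝ (Fin (dimE ρ))} (ha : ‖a‖ ≤ 1 / 16) : ‖a‖ ≤ 2 * ‖ρ (expChart ρ a) - 1‖ := by
  have h := le_norm_rho_expChart_sub ρ hρ (a := a) (b := 0) (r := 1 / 16) ha (by simp)
  rw [sub_zero, expChart_zero ρ hρ hinj, map_one] at h
  have hexp : Real.exp (1 / 16) ≤ 3 / 2 := by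
    have := exp_four_mul_le (r := 1 / 64) (by norm_num)
    norm_num at this; exact this.trans (by norm_num)
  nlinarith [norm_nonneg a, norm_nonneg (ρ (expChart ρ a) - 1)]

include hρu in
/-- **The sup-norm chart-coordinate bound on the small-field event, every compact group presented in `U(N)`.**  If the links of `V`
are chart points `V e = expChart ρ (a e)` with `‖a e‖ ≤ 1/16`, `V` is `1` off the cold box and on the temporal forest, and every plaquette
touching the box costs `≤ δ²` (`δ ≥ 0`, `H ≥ 1`), then every chart coordinate has `‖a e‖ ≤ 2·(12H² + 2H + 1)·√2·δ`. -/
theorem norm_chart_le_of_plaqCost_le (hρ : Continuous ρ) (hinj : Function.Injective ρ) (hH : 1 ≤ H) (V : LGConfig 4 G)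
    (hout : ∀ e, e ∉ boxEdges 4 (2 * H + 1) → V e = 1)
    (hforest : ∀ x : Site 4, (∀ k : Fin 4, 1 ≤ x k ∧ x k + 1 ≤ 2 * (H : ℤ)) → V (x, 0) = 1) {δ : ℝ} (hδ : 0 ≤ δ)
    (hcost : ∀ p ∈ plaquettesTouching (boxEdges 4 (2 * H + 1)), plaqCostAt ρ p.1 p.2.1.1 p.2.1.2 V ≤ δ ^ 2)
    (a : Literature.MathematicalPhysics.QuantumLattice.ZdEdge 4 → EuclideanSpace ℝ (Fin (dimE ρ)))
    (ha : ∀ e, ‖a e‖ ≤ 1 / 16) (hV : ∀ e, V e = expChart ρ (a e)) (e : Literature.MathematicalPhysics.QuantumLattice.ZdEdge 4) :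
    ‖a e‖ ≤ 2 * ((12 * (H : ℝ) ^ 2 + 2 * H + 1) * (Real.sqrt 2 * δ)) := by
  have h := frobDist_link_le_of_plaqCost_le ρ hρu hH V hout hforest hδ hcost e
  rw [hV e] at h
  exact (norm_le_two_mul_frobDist_expChart ρ hρ hinj (ha e)).trans (by linarith)

include hρu in
/-- The same bound from STRICT plaquette-cost inequalities `< δ²` (the form of the small-field event). -/
theorem norm_chart_le_of_plaqCost_lt (hρ : Continuous ρ) (hinj : Function.Injective ρ) (hH : 1 ≤ H) (V : LGConfig 4 G)
    (hout : ∀ e, e ∉ boxEdges 4 (2 * H + 1) → V e = 1)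
    (hforest : ∀ x : Site 4, (∀ k : Fin 4, 1 ≤ x k ∧ x k + 1 ≤ 2 * (H : ℤ)) → V (x, 0) = 1) {δ : ℝ} (hδ : 0 ≤ δ)
    (hcost : ∀ p ∈ plaquettesTouching (boxEdges 4 (2 * H + 1)), plaqCostAt ρ p.1 p.2.1.1 p.2.1.2 V < δ ^ 2)
    (a : Literature.MathematicalPhysics.QuantumLattice.ZdEdge 4 → EuclideanSpace ℝ (Fin (dimE ρ)))
    (ha : ∀ e, ‖a e‖ ≤ 1 / 16) (hV : ∀ e, V e = expChart ρ (a e)) (e : Literature.MathematicalPhysics.QuantumLattice.ZdEdge 4) :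
    ‖a e‖ ≤ 2 * ((12 * (H : ℝ) ^ 2 + 2 * H + 1) * (Real.sqrt 2 * δ)) :=
  norm_chart_le_of_plaqCost_le ρ hρu hρ hinj hH V hout hforest hδ (fun p hp => (hcost p hp).le) a ha hV e

end Chart

end Summit.QuantumFields.YangMills.Theorems.ColdBoxAllGroups

end
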